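import Summits.Ventures.Crystal3D.Theorems.StickyWulffConstantNoReconstructionGainExactLocalReplication
import Summits.Ventures.Crystal3D.Theorems.StickyWulffConstantNoReconstructionGainCoplanarFilm
import HarnessLib

/-!
# No criminal is a union of planar off-lattice rafts (line `replication-exactness`)

HONEST FRAMING. Part of the venture `Summits/Ventures/Crystal3D` (cell `crystal3d-full`), supports the
crux `NoReconstructionGain` (stmt-Ventures-19144, route `route-Ventures-StickyWulffConstant`), line
`replication-exactness` (lead wulff-p1 g18).  Second instantiation of the LOCAL replication licence
`not_isCriminal_of_localAtom` (`…ExactLocalReplication`), with the landed rung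
`planarComponents_adhesion` (`…CoplanarFilm`: a film whose OFF-LATTICE contact components are planar
gains at most `C ρ` over the slab sample, every normal).  The film property "there are labels
`c, n` with every off-lattice ball `x` on the plane `⟪x − c x, n x⟫ = 0`, `n x ≠ 0`, constant along
unit bonds between off-lattice balls" is local: translation covariant (`c ↦ c(· − t) + t`,
`n ↦ n(· − t)`) and inherited by far unions (labels chosen copy by copy).

* `not_isCriminal_of_planarComponents` — such a film is not a criminal, on any face `H(ν,s)`;
* `not_isCriminal_of_coplanar_offLattice` — in particular a film whose off-lattice balls are
  COPLANAR (its lattice balls arbitrary) is never a criminal: no monolayer-type reconstruction gains.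

WHAT THIS IS NOT: non-planar off-lattice components are not covered; the crux is not moved; rung F-C1
not moved.
-/

noncomputable section

namespace Summit.Ventures.Crystal3D.Theorems

open Summit.Ventures.Crystal3D
open Literature.MathematicalPhysics.StatisticalMechanics (fccStacking contactDeficiency)
open scoped InnerProductSpace
open Finset

/-- Translation covariance of planar labels. -/
private theorem planarLabels_translate {F : Finset (EuclideanSpace ℝ (Fin 3))}
    (hF : (∃ c n : EuclideanSpace ℝ (Fin 3) → EuclideanSpace ℝ (Fin 3),
      (∀ x ∈ F, x ∉ fccStacking 1 (Real.sqrt (2 / 3)) → n x ≠ 0 ∧ ⟪x - c x, n x⟫_ℝ = 0) ∧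
      (∀ x ∈ F, ∀ y ∈ F, x ∉ fccStacking 1 (Real.sqrt (2 / 3)) →
        y ∉ fccStacking 1 (Real.sqrt (2 / 3)) → dist x y = 1 → c x = c y ∧ n x = n y)))
    {t : EuclideanSpace ℝ (Fin 3)} (ht : t ∈ fccStacking 1 (Real.sqrt (2 / 3))) :
    (∃ c n : EuclideanSpace ℝ (Fin 3) → EuclideanSpace ℝ (Fin 3),
      (∀ x ∈ F.image fun q => q + t, x ∉ fccStacking 1 (Real.sqrt (2 / 3)) → n x ≠ 0 ∧ ⟪x - c x, n x⟫_ℝ = 0) ∧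
      (∀ x ∈ F.image fun q => q + t, ∀ y ∈ F.image fun q => q + t, x ∉ fccStacking 1 (Real.sqrt (2 / 3)) →
        y ∉ fccStacking 1 (Real.sqrt (2 / 3)) → dist x y = 1 → c x = c y ∧ n x = n y)) := by
  classical
  obtain ⟨c, n, h1, h2⟩ := hF
  have hoff : ∀ q, q + t ∉ fccStacking 1 (Real.sqrt (2 / 3)) → q ∉ fccStacking 1 (Real.sqrt (2 / 3)) :=
    fun q hq hqΛ => hq (fcc_add_site_mem hqΛ ht)
  refine ⟨fun x => c (x - t) + t, fun x => n (x - t), fun x hx hxΛ => ?_, fun x hx y hy hxΛ hyΛ hd => ?_⟩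
  · obtain ⟨q, hq, rfl⟩ := Finset.mem_image.1 hx
    obtain ⟨hn, hc⟩ := h1 q hq (hoff q hxΛ)
    refine ⟨by simpa only [add_sub_cancel_right] using hn, ?_⟩
    have e : q + t - (c (q + t - t) + t) = q - c q := by rw [add_sub_cancel_right]; abel
    show ⟪q + t - (c (q + t - t) + t), n (q + t - t)⟫_ℝ = 0
    rw [e, add_sub_cancel_right]; exact hc
  · obtain ⟨q, hq, rfl⟩ := Finset.mem_image.1 hx
    obtain ⟨q', hq', rfl⟩ := Finset.mem_image.1 hy
    rw [dist_add_right] at hd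
    obtain ⟨hc, hn⟩ := h2 q hq q' hq' (hoff q hxΛ) (hoff q' hyΛ) hd
    simp only [add_sub_cancel_right, hc, hn, and_self]

/-- Far unions inherit planar labels (chosen copy by copy). -/
private theorem planarLabels_biUnion (T : Finset (EuclideanSpace ℝ (Fin 3)))
    (G : EuclideanSpace ℝ (Fin 3) → Finset (EuclideanSpace ℝ (Fin 3)))
    (hG : ∀ t ∈ T, (∃ c n : EuclideanSpace ℝ (Fin 3) → EuclideanSpace ℝ (Fin 3),
      (∀ x ∈ G t, x ∉ fccStacking 1 (Real.sqrt (2 / 3)) → n x ≠ 0 ∧ ⟪x - c x, n x⟫_ℝ = 0) ∧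
      (∀ x ∈ G t, ∀ y ∈ G t, x ∉ fccStacking 1 (Real.sqrt (2 / 3)) →
        y ∉ fccStacking 1 (Real.sqrt (2 / 3)) → dist x y = 1 → c x = c y ∧ n x = n y)))
    (hfar : ∀ t ∈ T, ∀ t' ∈ T, t ≠ t' → ∀ y ∈ G t, ∀ y' ∈ G t', 1 < dist y y') :
    (∃ c n : EuclideanSpace ℝ (Fin 3) → EuclideanSpace ℝ (Fin 3),
      (∀ x ∈ T.biUnion G, x ∉ fccStacking 1 (Real.sqrt (2 / 3)) → n x ≠ 0 ∧ ⟪x - c x, n x⟫_ℝ = 0) ∧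
      (∀ x ∈ T.biUnion G, ∀ y ∈ T.biUnion G, x ∉ fccStacking 1 (Real.sqrt (2 / 3)) →
        y ∉ fccStacking 1 (Real.sqrt (2 / 3)) → dist x y = 1 → c x = c y ∧ n x = n y)) := by
  classical
  -- total label functions, copy by copy
  have hG' : ∀ t, ∃ c n : EuclideanSpace ℝ (Fin 3) → EuclideanSpace ℝ (Fin 3), t ∈ T →
      (∀ x ∈ G t, x ∉ fccStacking 1 (Real.sqrt (2 / 3)) → n x ≠ 0 ∧ ⟪x - c x, n x⟫_ℝ = 0) ∧
      (∀ x ∈ G t, ∀ y ∈ G t, x ∉ fccStacking 1 (Real.sqrt (2 / 3)) →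
        y ∉ fccStacking 1 (Real.sqrt (2 / 3)) → dist x y = 1 → c x = c y ∧ n x = n y) := by
    intro t
    by_cases ht : t ∈ T
    · obtain ⟨c, n, h1, h2⟩ := hG t ht
      exact ⟨c, n, fun _ => ⟨h1, h2⟩⟩
    · exact ⟨fun x => x, fun x => x, fun h => absurd h ht⟩
  choose c n hcn using hG'
  -- the copy containing a ball is unique
  have huniq : ∀ x, ∀ t ∈ T, x ∈ G t → ∀ t' ∈ T, x ∈ G t' → t = t' := by
    intro x t ht hx t' ht' hx'
    by_contra hne
    have := hfar t ht t' ht' hne x hx x hx'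
    rw [dist_self] at this
    linarith only [this]
  set sel : EuclideanSpace ℝ (Fin 3) → EuclideanSpace ℝ (Fin 3) :=
    fun x => if h : ∃ t, t ∈ T ∧ x ∈ G t then Classical.choose h else 0 with hsel
  have hselt : ∀ t ∈ T, ∀ x ∈ G t, sel x = t := by
    intro t ht x hx
    have h : ∃ t, t ∈ T ∧ x ∈ G t := ⟨t, ht, hx⟩
    have e : sel x = Classical.choose h := by rw [hsel]; exact dif_pos h
    rw [e]
    exact huniq x _ (Classical.choose_spec h).1 (Classical.choose_spec h).2 t ht hx
  refine ⟨fun x => c (sel x) x, fun x => n (sel x) x, fun x hx hxΛ => ?_, fun x hx y hy hxΛ hyΛ hd => ?_⟩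
  · obtain ⟨t, ht, hxt⟩ := Finset.mem_biUnion.1 hx
    simp only [hselt t ht x hxt]
    exact ((hcn t) ht).1 x hxt hxΛ
  · obtain ⟨t, ht, hxt⟩ := Finset.mem_biUnion.1 hx
    obtain ⟨t', ht', hyt⟩ := Finset.mem_biUnion.1 hy
    have htt : t = t' := by
      by_contra hne
      have := hfar t ht t' ht' hne x hxt y hyt
      rw [hd] at this
      exact lt_irrefl _ this
    subst htt
    simp only [hselt t ht x hxt, hselt t ht y hyt]
    exact ((hcn t) ht).2 x hxt y hyt hxΛ hyΛ hd

/-- **No criminal has planar off-lattice components.**  If labels `c, n` put every off-lattice ball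
`x` of the film on a plane `⟪x − c x, n x⟫ = 0` (`n x ≠ 0`) and are constant along unit bonds between
off-lattice balls (each off-lattice contact component is planar; lattice balls arbitrary), the film
is not a criminal, on any face. -/
theorem not_isCriminal_of_planarComponents {ν : EuclideanSpace ℝ (Fin 3)} (hν : ‖ν‖ = 1) {s : ℝ}
    {Q : Finset (EuclideanSpace ℝ (Fin 3))} (c n : EuclideanSpace ℝ (Fin 3) → EuclideanSpace ℝ (Fin 3))
    (hplane : ∀ x ∈ Q, x ∉ fccStacking 1 (Real.sqrt (2 / 3)) → n x ≠ 0 ∧ ⟪x - c x, n x⟫_ℝ = 0)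
    (hbond : ∀ x ∈ Q, ∀ y ∈ Q, x ∉ fccStacking 1 (Real.sqrt (2 / 3)) →
      y ∉ fccStacking 1 (Real.sqrt (2 / 3)) → dist x y = 1 → c x = c y ∧ n x = n y) :
    ¬ IsCriminal ν s Q := by
  obtain ⟨R, C, hR, h⟩ := planarComponents_adhesion
  refine not_isCriminal_of_localAtom
    (Pf := fun F => (∃ c n : EuclideanSpace ℝ (Fin 3) → EuclideanSpace ℝ (Fin 3),
      (∀ x ∈ F, x ∉ fccStacking 1 (Real.sqrt (2 / 3)) → n x ≠ 0 ∧ ⟪x - c x, n x⟫_ℝ = 0) ∧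
      (∀ x ∈ F, ∀ y ∈ F, x ∉ fccStacking 1 (Real.sqrt (2 / 3)) →
        y ∉ fccStacking 1 (Real.sqrt (2 / 3)) → dist x y = 1 → c x = c y ∧ n x = n y))) (C := C)
    (fun F hF t ht => planarLabels_translate hF ht) planarLabels_biUnion hν hR
    (fun ρ hρ X P hpack hPX hP hPf _ => h ν hν ρ hρ X P hpack hPX hP hPf) ⟨c, n, hplane, hbond⟩

/-- **No monolayer-type criminal.**  A film whose off-lattice balls are coplanar (on one plane
`⟪x − c₀, n₀⟫ = 0`, `n₀ ≠ 0`; its lattice balls arbitrary) is not a criminal, on any face. -/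
theorem not_isCriminal_of_coplanar_offLattice {ν : EuclideanSpace ℝ (Fin 3)} (hν : ‖ν‖ = 1) {s : ℝ}
    {Q : Finset (EuclideanSpace ℝ (Fin 3))} {c₀ n₀ : EuclideanSpace ℝ (Fin 3)} (hn₀ : n₀ ≠ 0)
    (hplane : ∀ x ∈ Q, x ∉ fccStacking 1 (Real.sqrt (2 / 3)) → ⟪x - c₀, n₀⟫_ℝ = 0) :
    ¬ IsCriminal ν s Q :=
  not_isCriminal_of_planarComponents hν (fun _ => c₀) (fun _ => n₀)
    (fun x hx hxΛ => ⟨hn₀, hplane x hx hxΛ⟩) fun _ _ _ _ _ _ _ => ⟨rfl, rfl⟩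

end Summit.Ventures.Crystal3D.Theorems

end
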